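import Literature.Topology.FourManifolds.BoundarySignature
import Mathlib.Geometry.Manifold.IsManifold.InteriorBoundary
import Mathlib.Topology.Compactification.OnePoint.Basic
import HarnessLib

/-!
# Pieces of the closed model `W ∪ cone(∂W)` over the clopen pieces of `W`

Topic `Literature/Topology/FourManifolds`; proofs file of the fact seat of
`Literature.Topology.FourManifolds.HomotopySphere.exists_mem_signatureSet_iff_eight_dvd`
(M. Kervaire, J. Milnor, *Groups of homotopy spheres I*, Ann. of Math. 77 (1963), §7, p. 530),
for the divisibility half `8 ∣ σ(M)` over an ARBITRARY — possibly disconnected — s-parallelizable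
null-cobordism `M` (`HomotopySphere.eight_dvd_of_mem_signatureSet_of_isEven` asks for the
evenness of the intersection form of the closed model of every such `M`; the Wu-class argument,
`Literature.AlgebraicTopology.SingularHomology.steenrodSqLower_eq_zero_of_tube`, treats one
connected component at a time). Everything here is point-set topology and is **proved**; no
definition, no named fact (D-0026).

Let `W` be a compact `C¹` manifold with boundary (model `𝓡∂ (n + 1)`), `W° = W ∖ ∂W` its
interior (`ManifoldInterior n W = ↥W°`) and `Ŵ = OnePoint W° = W ∪ cone(∂W)` the closed model
(`ClosedModel n W`, `BoundarySignature.lean`; Kervaire–Milnor, footnote pp. 528–529). For a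
subset `C ⊆ W` write `C° = {x ∈ W° | x ∈ C} ⊆ Ŵ` and `Ĉ = {∞} ∪ C° ⊆ Ŵ`.

* `isOpen_image_coe_of_isOpen` / `isClosed_image_coe_of_isClosed` — for `V ⊆ W` open, `V° ⊆ Ŵ`
  is open; for `V` closed and contained in `W°`, `V° ⊆ Ŵ` is closed (it is compact);
* `compl_image_coe_compl` — `Ŵ ∖ (Cᶜ)° = Ĉ`; hence for `U ⊆ W` closed, `Û` is closed, and for `U`
  open with `W ∖ U ⊆ W°`, `Û` is open (`isClosed_hat_of_isClosed`, `isOpen_hat_of_isOpen`);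
* `nonempty_closedModel_opens_homeomorph_hat` — **for an open and closed `U ⊆ W`, the closed
  model of the open submanifold `U` is the piece `Û` of `Ŵ`**: `ClosedModel n ↥U ≃ₜ ↥Û`
  (Mathlib's characterisation of the Alexandroff compactification,
  `OnePoint.equivOfIsEmbeddingOfRangeEq`, applied to the embedding `(↥U)° → Û` whose range misses
  exactly `∞`; the interior of the open submanifold `U` is `U ∩ W°`,
  `ModelWithCorners.interior_open`);
* `nonempty_onePoint_homeomorph_insert_image_coe` — for `V ⊆ W` closed and contained in `W°`
  (a union of closed components), `OnePoint ↥(V ∩ W°) ≃ₜ ↥({∞} ∪ V°)` — the one-point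
  compactification `V ⊔ {∞}` of the compact `V`, as a piece of `Ŵ`.

These identify the two kinds of pieces of `Ŵ` — the closed model of the component of the
boundary, and the closed components with `∞` adjoined — with one-point compactifications of
tubed open subsets, to which the tube argument applies.

## References

* M. Kervaire, J. Milnor, *Groups of homotopy spheres I*, Ann. of Math. 77 (1963), §7, footnote
  pp. 528–529. [KervaireMilnorAnnals1963]
* N. Bourbaki, *General Topology*, Ch. I §9.8, Thm. 4 (uniqueness of the Alexandroff
  compactification). [folklore]
-/

open scoped Manifold ContDiff Topology
open Set Function OnePoint

noncomputable section

universe u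

namespace Literature.Topology.FourManifolds

namespace ClosedModel

variable {n : ℕ} {W : Type u} [TopologicalSpace W] [T2Space W] [CompactSpace W]
  [ChartedSpace (EuclideanHalfSpace (n + 1)) W] [IsManifold (𝓡∂ (n + 1)) 1 W]

/-! ### The pieces `C°` and `Ĉ` of the closed model -/

omit [T2Space W] [CompactSpace W] [IsManifold (𝓡∂ (n + 1)) 1 W] in
/-- For `V ⊆ W` open, `V° = {x ∈ W° | x ∈ V}` is open in `Ŵ` (the interior embeds openly).
[folklore] -/
theorem isOpen_image_coe_of_isOpen {V : Set W} (hV : IsOpen V) :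
    IsOpen ((ClosedModel.ofInterior : ManifoldInterior n W → ClosedModel n W) '' {x | x.1 ∈ V}) :=
  OnePoint.isOpen_image_coe.2 (hV.preimage continuous_subtype_val)

omit [T2Space W] [CompactSpace W] [IsManifold (𝓡∂ (n + 1)) 1 W] in
/-- For `V ⊆ W` compact and contained in `W°`, `{x ∈ W° | x ∈ V}` is compact (it is
homeomorphic to `V`). [folklore] -/
theorem isCompact_setOf_coe_mem {V : Set W} (hVc : IsCompact V)
    (hV : V ⊆ (𝓡∂ (n + 1)).interior W) : IsCompact {x : ManifoldInterior n W | x.1 ∈ V} := by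
  have hv : Topology.IsInducing (Subtype.val : ManifoldInterior n W → W) :=
    Topology.IsInducing.subtypeVal
  have h : (Subtype.val : ManifoldInterior n W → W) '' {x : ManifoldInterior n W | x.1 ∈ V} = V := by
    refine Subset.antisymm ?_ fun w hw => ⟨⟨w, hV hw⟩, hw, rfl⟩
    rintro _ ⟨x, hx, rfl⟩; exact hx
  exact hv.isCompact_iff.2 ((congrArg IsCompact h).mpr hVc)

omit [T2Space W] [IsManifold (𝓡∂ (n + 1)) 1 W] in
/-- For `V ⊆ W` closed and contained in `W°`, `V° ⊆ Ŵ` is closed. [folklore] -/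
theorem isClosed_image_coe_of_isClosed {V : Set W} (hVcl : IsClosed V)
    (hV : V ⊆ (𝓡∂ (n + 1)).interior W) :
    IsClosed ((ClosedModel.ofInterior : ManifoldInterior n W → ClosedModel n W) '' {x | x.1 ∈ V}) :=
  OnePoint.isClosed_image_coe.2
    ⟨hVcl.preimage continuous_subtype_val, isCompact_setOf_coe_mem hVcl.isCompact hV⟩

omit [T2Space W] [CompactSpace W] [IsManifold (𝓡∂ (n + 1)) 1 W] in
/-- `Ŵ ∖ (Cᶜ)° = Ĉ = {∞} ∪ C°`. [folklore] -/
theorem compl_image_coe_compl (C : Set W) :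
    ((ClosedModel.ofInterior : ManifoldInterior n W → ClosedModel n W) '' {x | x.1 ∈ Cᶜ})ᶜ =
      insert (ClosedModel.infty : ClosedModel n W) ((ClosedModel.ofInterior : ManifoldInterior n W → ClosedModel n W) '' {x | x.1 ∈ C}) := by
  have h : ({x : ManifoldInterior n W | x.1 ∈ Cᶜ})ᶜ = {x | x.1 ∈ C} := by
    ext x; simp
  have h2 := OnePoint.compl_image_coe (X := ManifoldInterior n W) {x | x.1 ∈ Cᶜ}
  rw [h, union_singleton] at h2
  exact h2

omit [T2Space W] [CompactSpace W] [IsManifold (𝓡∂ (n + 1)) 1 W] in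
/-- For `U ⊆ W` closed, `Û = {∞} ∪ U°` is closed in `Ŵ` (its complement `(Uᶜ)°` is open).
[folklore] -/
theorem isClosed_hat_of_isClosed {U : Set W} (hU : IsClosed U) :
    IsClosed (insert (ClosedModel.infty : ClosedModel n W) ((ClosedModel.ofInterior : ManifoldInterior n W → ClosedModel n W) '' {x | x.1 ∈ U})) := by
  rw [← compl_image_coe_compl, isClosed_compl_iff]
  exact isOpen_image_coe_of_isOpen hU.isOpen_compl

omit [T2Space W] [IsManifold (𝓡∂ (n + 1)) 1 W] in
/-- For `U ⊆ W` open with `W ∖ U ⊆ W°` (i.e. `∂W ⊆ U`), `Û = {∞} ∪ U°` is open in `Ŵ` (its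
complement `(Uᶜ)°` is compact). [folklore] -/
theorem isOpen_hat_of_isOpen {U : Set W} (hU : IsOpen U) (hbd : Uᶜ ⊆ (𝓡∂ (n + 1)).interior W) :
    IsOpen (insert (ClosedModel.infty : ClosedModel n W) ((ClosedModel.ofInterior : ManifoldInterior n W → ClosedModel n W) '' {x | x.1 ∈ U})) := by
  rw [← compl_image_coe_compl, isOpen_compl_iff]
  exact isClosed_image_coe_of_isClosed hU.isClosed_compl hbd

omit [T2Space W] [CompactSpace W] [IsManifold (𝓡∂ (n + 1)) 1 W] in
/-- `Û ∪ (Uᶜ)° = Ŵ`. [folklore] -/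
theorem hat_union_image_coe_compl (U : Set W) :
    insert (ClosedModel.infty : ClosedModel n W) ((ClosedModel.ofInterior : ManifoldInterior n W → ClosedModel n W) '' {x | x.1 ∈ U}) ∪
      (ClosedModel.ofInterior : ManifoldInterior n W → ClosedModel n W) '' {x | x.1 ∈ Uᶜ} = univ := by
  rw [← compl_image_coe_compl, compl_union_self]

omit [T2Space W] [CompactSpace W] [IsManifold (𝓡∂ (n + 1)) 1 W] in
/-- `Û ∩ (Uᶜ)° = ∅`. [folklore] -/
theorem hat_inter_image_coe_compl (U : Set W) :
    insert (ClosedModel.infty : ClosedModel n W) ((ClosedModel.ofInterior : ManifoldInterior n W → ClosedModel n W) '' {x | x.1 ∈ U}) ∩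
      (ClosedModel.ofInterior : ManifoldInterior n W → ClosedModel n W) '' {x | x.1 ∈ Uᶜ} = ∅ := by
  rw [← compl_image_coe_compl, compl_inter_self]

/-! ### The closed model of an open-closed submanifold is a piece of `Ŵ` -/

/-- **`ClosedModel n ↥U ≃ₜ Û` for `U ⊆ W` open and closed**: the closed model
`U ∪ cone(∂U)` of the open submanifold `U` (whose interior is `U ∩ W°`,
`ModelWithCorners.interior_open`) is the one-point compactification of `U ∩ W°`; the piece
`Û = {∞} ∪ U° ⊆ Ŵ` is compact Hausdorff and `U ∩ W° → Û` is an embedding whose range misses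
exactly `∞`, so `Û` IS that compactification (`OnePoint.equivOfIsEmbeddingOfRangeEq`).
[folklore] -/
theorem nonempty_closedModel_opens_homeomorph_hat (U : TopologicalSpace.Opens W)
    (hU : IsClosed (U : Set W)) :
    Nonempty (ClosedModel n (U : Type u) ≃ₜ
      ↥(insert (ClosedModel.infty : ClosedModel n W)
        ((ClosedModel.ofInterior : ManifoldInterior n W → ClosedModel n W) '' {x | x.1 ∈ (U : Set W)}))) := by
  set T : Set (ClosedModel n W) := insert (ClosedModel.infty : ClosedModel n W)
    ((ClosedModel.ofInterior : ManifoldInterior n W → ClosedModel n W) '' {x | x.1 ∈ (U : Set W)}) with hT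
  haveI : CompactSpace ↥T := isCompact_iff_compactSpace.1 (isClosed_hat_of_isClosed hU).isCompact
  -- the interior of the open submanifold `U` is `U ∩ W°`
  have hint : ∀ x : ManifoldInterior n (U : Type u), x.1.1 ∈ (𝓡∂ (n + 1)).interior W :=
    fun x => (𝓡∂ (n + 1)).isInteriorPoint_iff_isInteriorPoint_val.1 x.2
  -- the embedding `(↥U)° → Û`
  let g : ManifoldInterior n (U : Type u) → ManifoldInterior n W := fun x => ⟨x.1.1, hint x⟩
  have hvW : Topology.IsEmbedding (Subtype.val : ManifoldInterior n W → W) :=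
    Topology.IsEmbedding.subtypeVal
  have hvU : Topology.IsEmbedding (Subtype.val : ManifoldInterior n (U : Type u) → (U : Type u)) :=
    Topology.IsEmbedding.subtypeVal
  have hg : Topology.IsEmbedding g :=
    hvW.of_comp_iff.1 ((Topology.IsEmbedding.subtypeVal (p := fun w : W => w ∈ (U : Set W))).comp hvU)
  have hmem : ∀ x : ManifoldInterior n (U : Type u), ClosedModel.ofInterior (g x) ∈ T :=
    fun x => mem_insert_of_mem _ ⟨g x, x.1.2, rfl⟩
  let f : ManifoldInterior n (U : Type u) → ↥T := fun x => ⟨ClosedModel.ofInterior (g x), hmem x⟩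
  have hcoe : Topology.IsEmbedding (ClosedModel.ofInterior : ManifoldInterior n W → ClosedModel n W) :=
    OnePoint.isOpenEmbedding_coe.isEmbedding
  have hf : Topology.IsEmbedding f := (hcoe.comp hg).codRestrict T hmem
  have hy : range f = {(⟨ClosedModel.infty, mem_insert _ _⟩ : ↥T)}ᶜ := by
    ext z
    simp only [mem_range, mem_compl_iff, mem_singleton_iff]
    constructor
    · rintro ⟨x, rfl⟩ h
      exact OnePoint.coe_ne_infty (g x) (congrArg Subtype.val h)
    · intro hz
      have hz1 : (z : ClosedModel n W) ≠ ClosedModel.infty := fun h => hz (Subtype.ext h)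
      obtain ⟨w, hw, hwz⟩ : (z : ClosedModel n W) ∈
          (ClosedModel.ofInterior : ManifoldInterior n W → ClosedModel n W) '' {x | x.1 ∈ (U : Set W)} :=
        (mem_insert_iff.1 z.2).resolve_left hz1
      refine ⟨⟨⟨w.1, hw⟩, ?_⟩, Subtype.ext ?_⟩
      · exact (𝓡∂ (n + 1)).isInteriorPoint_iff_isInteriorPoint_val.2 w.2
      · exact hwz
  exact ⟨OnePoint.equivOfIsEmbeddingOfRangeEq _ f hf hy⟩

/-! ### The closed pieces with `∞` adjoined -/

/-- **`OnePoint ↥(V ∩ W°) ≃ₜ {∞} ∪ V°` for `V ⊆ W` closed** (e.g. a union of closed components of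
`W`, for which `V ∩ W° = V` and `{∞} ∪ V° = V ⊔ {∞}`): the piece `{∞} ∪ V°` of `Ŵ` is compact
Hausdorff and `V ∩ W° → {∞} ∪ V°` is an embedding whose range misses exactly `∞`
(`OnePoint.equivOfIsEmbeddingOfRangeEq`). Here `V ∩ W°` is taken as the subset `val ⁻¹' W°` of
`↥V`, the shape in which the tube argument over the compact space `↥V` produces it. [folklore] -/
theorem nonempty_onePoint_homeomorph_insert_image_coe {V : Set W} (hVcl : IsClosed V) :
    Nonempty (OnePoint ↥((Subtype.val : ↥V → W) ⁻¹' (𝓡∂ (n + 1)).interior W) ≃ₜ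
      ↥(insert (ClosedModel.infty : ClosedModel n W)
        ((ClosedModel.ofInterior : ManifoldInterior n W → ClosedModel n W) '' {x | x.1 ∈ V}))) := by
  set T : Set (ClosedModel n W) := insert (ClosedModel.infty : ClosedModel n W)
    ((ClosedModel.ofInterior : ManifoldInterior n W → ClosedModel n W) '' {x | x.1 ∈ V}) with hT
  have hTcl : IsClosed T := isClosed_hat_of_isClosed hVcl
  haveI : CompactSpace ↥T := isCompact_iff_compactSpace.1 hTcl.isCompact
  let g : ↥((Subtype.val : ↥V → W) ⁻¹' (𝓡∂ (n + 1)).interior W) → ManifoldInterior n W :=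
    fun a => ⟨a.1.1, a.2⟩
  have hvW : Topology.IsEmbedding (Subtype.val : ManifoldInterior n W → W) :=
    Topology.IsEmbedding.subtypeVal
  have hg : Topology.IsEmbedding g :=
    hvW.of_comp_iff.1 ((Topology.IsEmbedding.subtypeVal (p := fun w : W => w ∈ V)).comp
      Topology.IsEmbedding.subtypeVal)
  have hmem : ∀ a, ClosedModel.ofInterior (g a) ∈ T :=
    fun a => mem_insert_of_mem _ ⟨g a, a.1.2, rfl⟩
  let f : ↥((Subtype.val : ↥V → W) ⁻¹' (𝓡∂ (n + 1)).interior W) → ↥T :=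
    fun a => ⟨ClosedModel.ofInterior (g a), hmem a⟩
  have hcoe : Topology.IsEmbedding (ClosedModel.ofInterior : ManifoldInterior n W → ClosedModel n W) :=
    OnePoint.isOpenEmbedding_coe.isEmbedding
  have hf : Topology.IsEmbedding f := (hcoe.comp hg).codRestrict T hmem
  have hy : range f = {(⟨ClosedModel.infty, mem_insert _ _⟩ : ↥T)}ᶜ := by
    ext z
    simp only [mem_range, mem_compl_iff, mem_singleton_iff]
    constructor
    · rintro ⟨x, rfl⟩ h
      exact OnePoint.coe_ne_infty (g x) (congrArg Subtype.val h)
    · intro hz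
      have hz1 : (z : ClosedModel n W) ≠ ClosedModel.infty := fun h => hz (Subtype.ext h)
      obtain ⟨w, hw, hwz⟩ : (z : ClosedModel n W) ∈
          (ClosedModel.ofInterior : ManifoldInterior n W → ClosedModel n W) '' {x | x.1 ∈ V} :=
        (mem_insert_iff.1 z.2).resolve_left hz1
      exact ⟨⟨⟨w.1, hw⟩, w.2⟩, Subtype.ext hwz⟩
  exact ⟨OnePoint.equivOfIsEmbeddingOfRangeEq _ f hf hy⟩

end ClosedModel

end Literature.Topology.FourManifolds
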